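import Literature.Computation.Certificates.KeyedTableStream

/-!
# Table contribution streams, II: packed tables and family sums

Companion of `KeyedTableStream` in the «K-STREAM» lane. Proved here: a packed term table evaluates
as the sum of its terms (`PTab.eval_toSTerms`); the contributions of an EQUALITY family sum to
`cf · μ(x) · h(x)` (`Family.sum_contrib_eq`); those of an INEQUALITY family to
`cf · (m_σ(x)ᵀ W m_σ(x)) · g(x)` with `W` the symmetrised upper triangle of the small block
(`Family.sum_contrib_ineq`), hence to a nonnegative number once the block carries an integer Gram
certificate (`PSD.IsGramCertZ` of the packed rows — symmetric by `IsGramCertZ.isSymm`) and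
`g(x) ≥ 0` (`Family.sum_contrib_ineq_nonneg`). Products of keyed monomials use the carry-free
lemma `monoEval_add` under the table digit bounds `PTab.keysOK`.
[cite: BlekhermanParriloThomas2012, Thm 3.39, p. 65 and §3.1.4 eq. (3.12), p. 64]; codes
[cite: Harvey2009, §3.1].

WHAT THIS FILE IS NOT: the position↔id bijection and the assembly are the companions
`KeyedTableStreamIds` and `KeyedPositivstellensatz`.
-/

namespace Literature.Computation.Certificates

namespace SOS

namespace Keyed

open PSD


/-! ### Packed term tables -/

section Tables

variable {R : Type*} [Field R]

/-- Value of a sign–magnitude term list written with `List.map` over a range.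
[cite: BlekhermanParriloThomas2012, §3.1.4 eq. (3.12), p. 64] -/
theorem eval_toZ_map_range (x : ℕ → R) (b n : ℕ) (f : ℕ → ℕ × Bool × ℕ) :
    ∀ N : ℕ, ZTerms.eval x b n (STerms.toZ ((List.range N).map f)) =
      ∑ t ∈ Finset.range N, ((sval (f t).2.1 (f t).2.2 : ℤ) : R) * monoEval x b n 0 (f t).1
  | 0 => by simp
  | N + 1 => by
    rw [List.range_succ, List.map_append, List.map_singleton, toZ_append, ZTerms.eval_append,
      eval_toZ_map_range x b n f N, Finset.sum_range_succ]
    rcases f N with ⟨k, sg, m⟩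
    simp

/-- **A packed term table evaluates as the sum of its terms.** [cite: Harvey2009, §3.1] -/
theorem PTab.eval_toSTerms (x : ℕ → R) (b n : ℕ) (T : PTab) :
    ZTerms.eval x b n (STerms.toZ T.toSTerms) =
      ∑ t ∈ Finset.range T.n, ((sval (T.sgn t) (T.mag t) : ℤ) : R) * monoEval x b n 0 (T.key t) :=
  eval_toZ_map_range x b n _ T.n

/-- The value of a packed table as a function (shorthand). [cite: Harvey2009, §3.1] -/
def PTab.val (x : ℕ → R) (b n : ℕ) (T : PTab) : R := ZTerms.eval x b n (STerms.toZ T.toSTerms)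

/-- Signs multiply as `xor`, magnitudes multiply. [folklore] -/
private theorem sval_beq_mul (s₁ s₂ : Bool) (m₁ m₂ : ℕ) :
    sval (s₁ == s₂) (m₁ * m₂) = sval s₁ m₁ * sval s₂ m₂ := by
  unfold sval; cases s₁ <;> cases s₂ <;> push_cast <;> simp

/-- **Key digit bounds of a table** as one Boolean. [cite: Harvey2009, §3.1] -/
def PTab.keysOK (T : PTab) (b D n : ℕ) : Bool := (List.range T.n).all fun t => digitsLe b D n (T.key t)

/-- `PTab.keysOK` gives the digit bound of every key. [cite: Harvey2009, §3.1] -/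
theorem PTab.digitsLe_of_keysOK {T : PTab} {b D n : ℕ} (h : T.keysOK b D n = true) :
    ∀ t < T.n, digitsLe b D n (T.key t) = true := by
  intro t ht; simp only [PTab.keysOK, List.all_eq_true, List.mem_range] at h; exact h t ht

end Tables

/-! ### Family sums -/

section Families

variable {R : Type*} [Field R]

/-- Value of one contribution `(key, sign, magnitude)`. [cite: BlekhermanParriloThomas2012, §3.1.4 eq. (3.12), p. 64] -/
def cval (x : ℕ → R) (b n : ℕ) (kc : ℕ × Bool × ℕ) : R :=
  ((sval kc.2.1 kc.2.2 : ℤ) : R) * monoEval x b n 0 kc.1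

/-- Sum over `range (A * B)` as a double sum (`l = α·B + τ`). [folklore] -/
private theorem sum_range_mul_eq {M : Type*} [AddCommMonoid M] (A B : ℕ) (f : ℕ → M) :
    ∑ l ∈ Finset.range (A * B), f l = ∑ α ∈ Finset.range A, ∑ τ ∈ Finset.range B, f (α * B + τ) := by
  induction A with
  | zero => simp
  | succ A ih => rw [Nat.succ_mul, Finset.sum_range_add, ih, Finset.sum_range_succ]

/-- **EQUALITY family**: the contributions sum to `cf · μ(x) · h(x)`.
[cite: BlekhermanParriloThomas2012, Thm 3.39, p. 65] -/
theorem Family.sum_contrib_eq (x : ℕ → R) {b n DA DT : ℕ} (F : Family) (hF : F.ineq = false)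
    (hA : F.A.keysOK b DA n = true) (hT : F.T.keysOK b DT n = true) (hD : DA + DT < b) :
    ∑ l ∈ Finset.range F.size, cval x b n (F.contribLocal l) =
      (F.cf : R) * F.A.val x b n * F.T.val x b n := by
  have hsize : F.size = F.A.n * F.T.n := by simp [Family.size, hF]
  rw [hsize, sum_range_mul_eq, PTab.val, PTab.val, PTab.eval_toSTerms, PTab.eval_toSTerms, mul_assoc,
    Finset.sum_mul_sum, Finset.mul_sum]
  refine Finset.sum_congr rfl fun α hα => ?_
  rw [Finset.mul_sum]
  refine Finset.sum_congr rfl fun τ hτ => ?_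
  rw [Finset.mem_range] at hα hτ
  have hTn : 0 < F.T.n := by omega
  have hdiv : (α * F.T.n + τ) / F.T.n = α := by
    rw [Nat.add_comm, Nat.add_mul_div_right _ _ hTn, Nat.div_eq_of_lt hτ, zero_add]
  have hmod : (α * F.T.n + τ) % F.T.n = τ := by
    rw [Nat.add_comm, Nat.add_mul_mod_self_right, Nat.mod_eq_of_lt hτ]
  simp only [Family.contribLocal, hF, hdiv, hmod, cval, Bool.false_eq_true, if_false]
  rw [show F.cf * F.A.mag α * F.T.mag τ = F.cf * (F.A.mag α * F.T.mag τ) by ring,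
    show sval (F.A.sgn α == F.T.sgn τ) (F.cf * (F.A.mag α * F.T.mag τ)) =
      (F.cf : ℤ) * (sval (F.A.sgn α) (F.A.mag α) * sval (F.T.sgn τ) (F.T.mag τ)) by
        rw [← sval_beq_mul]; unfold sval; split <;> push_cast <;> ring,
    monoEval_add x hD n 0 _ _ (PTab.digitsLe_of_keysOK hA α hα) (PTab.digitsLe_of_keysOK hT τ hτ)]
  push_cast; ring


/-- `sval` is multiplicative in the magnitude. [folklore] -/
private theorem sval_mul' (sg : Bool) (t m : ℕ) : sval sg (t * m) = (t : ℤ) * sval sg m := by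
  unfold sval; split <;> push_cast <;> ring

/-- The signed value of an offset digit. [folklore] -/
private theorem sval_offset (off d : ℕ) :
    sval (decide (off ≤ d)) (if off ≤ d then d - off else off - d) = (d : ℤ) - off := by
  unfold sval
  by_cases h : off ≤ d
  · rw [decide_eq_true h, if_pos h]; simp [Nat.cast_sub h]
  · rw [decide_eq_false h, if_neg h]; simp [Nat.cast_sub (le_of_not_ge h)]

/-- The signed integer matrix entry of an INEQ family's small Gram block: `qAt a b − 2^(wq−1)` —
the very `PSD.Packed.rowEntry` of the packed rows lane. [cite: Harvey2009, §3.1] -/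
def Family.qv (F : Family) (a b : ℕ) : ℤ := (F.qAt a b : ℤ) - ((2 ^ (F.wq - 1) : ℕ) : ℤ)

/-- **INEQUALITY family**: the contributions sum to `cf · (m_σᵀ W m_σ)(x) · g(x)` with `W` the
symmetrised upper triangle of the small block. [cite: BlekhermanParriloThomas2012, Thm 3.39, p. 65] -/
theorem Family.sum_contrib_ineq (x : ℕ → R) {b n DA DT : ℕ} (F : Family) (hF : F.ineq = true)
    (hA : F.A.keysOK b DA n = true) (hT : F.T.keysOK b DT n = true) (hD : DA + DA + DT < b) :
    ∑ l ∈ Finset.range F.size, cval x b n (F.contribLocal l) =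
      (F.cf : R) * (∑ a ∈ Finset.range F.A.n, ∑ c ∈ Finset.range F.A.n,
        monoEval x b n 0 (F.A.key a) * ((if a ≤ c then F.qv a c else F.qv c a : ℤ) : R) *
          monoEval x b n 0 (F.A.key c)) * F.T.val x b n := by
  have hsize : F.size = F.A.n * F.A.n * F.T.n := by simp [Family.size, hF]
  -- the pair sum as a sum over `upperPairs`, then as an indicator sum over the square
  have hsq := sum_pairs_eq_quadForm F.A.n (fun a c => (F.qv a c : R)) (fun a => monoEval x b n 0 (F.A.key a))
  have hite : ∀ a c : ℕ, ((if a ≤ c then F.qv a c else F.qv c a : ℤ) : R) =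
      (if a ≤ c then (F.qv a c : R) else (F.qv c a : R)) := fun a c => by split <;> rfl
  simp_rw [hite, ← hsq]
  rw [upperPairs, Finset.sum_filter, Finset.sum_product, hsize, sum_range_mul_eq, sum_range_mul_eq, PTab.val,
    PTab.eval_toSTerms, mul_assoc, Finset.sum_mul]
  simp_rw [Finset.sum_mul, Finset.mul_sum]
  refine Finset.sum_congr rfl fun a ha => ?_
  refine Finset.sum_congr rfl fun c hc => ?_
  rw [Finset.mem_range] at ha hc
  have hAn : 0 < F.A.n := by omega
  -- the inner sum over the terms of `g`
  by_cases hac : a ≤ c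
  · simp_rw [if_pos hac]
    refine Finset.sum_congr rfl fun τ hτ => ?_
    rw [Finset.mem_range] at hτ
    have hTn : 0 < F.T.n := by omega
    have hdiv : ((a * F.A.n + c) * F.T.n + τ) / F.T.n = a * F.A.n + c := by
      rw [Nat.add_comm, Nat.add_mul_div_right _ _ hTn, Nat.div_eq_of_lt hτ, zero_add]
    have hmod : ((a * F.A.n + c) * F.T.n + τ) % F.T.n = τ := by
      rw [Nat.add_comm, Nat.add_mul_mod_self_right, Nat.mod_eq_of_lt hτ]
    have hdiv2 : (a * F.A.n + c) / F.A.n = a := by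
      rw [Nat.add_comm, Nat.add_mul_div_right _ _ hAn, Nat.div_eq_of_lt hc, zero_add]
    have hmod2 : (a * F.A.n + c) % F.A.n = c := by
      rw [Nat.add_comm, Nat.add_mul_mod_self_right, Nat.mod_eq_of_lt hc]
    simp only [Family.contribLocal, hF, hdiv, hmod, hdiv2, hmod2, cval, if_true, if_pos hac]
    have hkey : monoEval x b n 0 (F.A.key a + F.A.key c + F.T.key τ) =
        monoEval x b n 0 (F.A.key a) * monoEval x b n 0 (F.A.key c) * monoEval x b n 0 (F.T.key τ) := by
      rw [monoEval_add x hD n 0 _ _ (digitsLe_add (by omega : DA + DA < b) n _ _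
            (PTab.digitsLe_of_keysOK hA a ha) (PTab.digitsLe_of_keysOK hA c hc)) (PTab.digitsLe_of_keysOK hT τ hτ),
        monoEval_add x (by omega : DA + DA < b) n 0 _ _ (PTab.digitsLe_of_keysOK hA a ha)
          (PTab.digitsLe_of_keysOK hA c hc)]
    rw [hkey, show F.cf * mult a c * (if 2 ^ (F.wq - 1) ≤ F.qAt a c then F.qAt a c - 2 ^ (F.wq - 1)
          else 2 ^ (F.wq - 1) - F.qAt a c) * F.T.mag τ =
        (F.cf * mult a c) * ((if 2 ^ (F.wq - 1) ≤ F.qAt a c then F.qAt a c - 2 ^ (F.wq - 1)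
          else 2 ^ (F.wq - 1) - F.qAt a c) * F.T.mag τ) by ring,
      sval_mul', sval_beq_mul, sval_offset, Family.qv]
    push_cast; ring
  · simp_rw [if_neg hac, zero_mul, mul_zero, Finset.sum_const_zero]
    refine Finset.sum_eq_zero fun τ hτ => ?_
    rw [Finset.mem_range] at hτ
    have hTn : 0 < F.T.n := by omega
    have hdiv : ((a * F.A.n + c) * F.T.n + τ) / F.T.n = a * F.A.n + c := by
      rw [Nat.add_comm, Nat.add_mul_div_right _ _ hTn, Nat.div_eq_of_lt hτ, zero_add]
    have hdiv2 : (a * F.A.n + c) / F.A.n = a := by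
      rw [Nat.add_comm, Nat.add_mul_div_right _ _ hAn, Nat.div_eq_of_lt hc, zero_add]
    have hmod2 : (a * F.A.n + c) % F.A.n = c := by
      rw [Nat.add_comm, Nat.add_mul_mod_self_right, Nat.mod_eq_of_lt hc]
    simp [Family.contribLocal, hF, hdiv, hdiv2, hmod2, cval, if_neg hac, sval]

section Ordered

variable {R' : Type*} [Field R'] [LinearOrder R'] [IsStrictOrderedRing R']

/-- **INEQUALITY family, positivity**: with an integer Gram certificate of the small block
(`PSD.IsGramCertZ` of `PSD.Packed.intMatrixRows s_σ wq Q`, e.g. from `PSD.Packed.checkRows` on the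
SAME rows) and `g(x) ≥ 0`, the family's contributions sum to a nonnegative number.
[cite: BlekhermanParriloThomas2012, Thm 3.39, p. 65] -/
theorem Family.sum_contrib_ineq_nonneg (x : ℕ → R') {b n DA DT m : ℕ} (F : Family) (hF : F.ineq = true)
    (hA : F.A.keysOK b DA n = true) (hT : F.T.keysOK b DT n = true) (hD : DA + DA + DT < b)
    {dd : Fin m → ℕ} {B : Matrix (Fin m) (Fin F.A.n) ℤ}
    (hQ : PSD.IsGramCertZ (PSD.Packed.intMatrixRows F.A.n F.wq F.Q) dd B) (hg : 0 ≤ F.T.val x b n) :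
    0 ≤ ∑ l ∈ Finset.range F.size, cval x b n (F.contribLocal l) := by
  rw [F.sum_contrib_ineq x hF hA hT hD]
  refine mul_nonneg (mul_nonneg (Nat.cast_nonneg _) ?_) hg
  have hsym := hQ.isSymm
  have hform := hQ.quadForm_nonneg (R := R') (fun i => monoEval x b n 0 (F.A.key i.val))
  rw [← Fin.sum_univ_eq_sum_range] 
  convert hform using 2 with i _
  rw [← Fin.sum_univ_eq_sum_range]
  refine Finset.sum_congr rfl fun j _ => ?_
  have hentry : ∀ i j : Fin F.A.n, PSD.Packed.intMatrixRows F.A.n F.wq F.Q i j = F.qv i.val j.val := by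
    intro i j; rfl
  by_cases h : i.val ≤ j.val
  · rw [if_pos h, hentry]
  · rw [if_neg h, ← hentry j i]
    have := hsym.apply j i
    rw [this]

end Ordered

end Families

end Keyed

end SOS

end Literature.Computation.Certificates
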